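import Summits.HubbardSuperconductivity.HubbardSuperconductivity.Theorems.ThermalWedgeTwSeededRungThermalWindow

/-!
Sketch for crux-ideate stmt-HubbardSuperconductivity-15417 (`TwThermalWindowRungGlue`), ideator 1, round 1.

The farm olean of `Theses/ThermalWedge.lean` is STALE (rev ≤ 6: `TwThermalWindowRungGlue`,
`TwSeededEnsembleEquivalenceR` unknown; `closes : TwSeededRung → TwTipContinuation → …`), so the first
lemmas are stated over VERBATIM LOCAL COPIES of the three route-decl bodies, extracted by script from
the rev-9 route file (assertion: glue body == `R → C → body(TwSeededRung)` textually). Once the farm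
rebuilds, replace `R'`/`C'`/`Rung'`/`Glue'` by the route decls (the proof terms are unchanged).
-/

set_option linter.dupNamespace false

namespace Summit.HubbardSuperconductivity.HubbardSuperconductivity.Cruxes.TwThermalWindowRungGlue.Sketch

open Literature.MathematicalPhysics.QuantumLattice Matrix
open Summit.HubbardSuperconductivity.HubbardSuperconductivity.Theorems

/-- verbatim body of `Theses.ThermalWedge.TwSeededEnsembleEquivalenceR` (rev 9). -/
def R' : Prop :=
  ∀ δ ∈ Set.Icc (1/10 : ℝ) (2/5 : ℝ), ∃ μ₁ μ₂ : ℝ, -4 < μ₁ ∧ μ₁ ≤ μ₂ ∧ μ₂ < 0 ∧ ∃ a K' U₀ : ℝ, 0 < a ∧ 0 < K' ∧ 0 < U₀ ∧ ∀ U ∈ Set.Ioc (0 : ℝ) U₀, ∀ g ∈ Set.Icc (K' * U) (1 / 10), ∀ β : ℝ, 1 ≤ β → β ≤ Real.exp (a / U) → ∃ μ ∈ Set.Icc μ₁ μ₂, ∀ ε : ℝ, 0 < ε → ∃ L₀ : ℕ, ∀ (L : ℕ) [NeZero L], L₀ ≤ L → (((Literature.MathematicalPhysics.QuantumLattice.hubbardTorus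 2 L 1 U - ((g / (L : ℝ) ^ 2 : ℝ) : ℂ) • ((Literature.MathematicalPhysics.QuantumLattice.pairField Literature.MathematicalPhysics.QuantumLattice.dWaveFormFactor L)ᴴ * Literature.MathematicalPhysics.QuantumLattice.pairField Literature.MathematicalPhysics.QuantumLattice.dWaveFormFactor L))).minEnergyOn (Literature.MathematicalPhysics.QuantumLattice.szSector (Λ := Literature.MathematicalPhysics.QuantumLattice.FermionTorus 2 L) (2 * ⌊(1 - δ) * (L : ℝ) ^ 2 / 2⌋₊) 0) / (L : ℝ) ^ 2) + (Real.log (Matrix.partitionFn β (Literature.MathematicalPhysics.QuantumLattice.hubbardTorusWith 2 L 1 U μ - ((g / (L : ℝ) ^ 2 : ℝ) : ℂ) • ((Literature.MathematicalPhysics.QuantumLattice.pairField Literature.MathematicalPhysics.QuantumLattice.dWaveFormFactor L)ᴴ * Literature.MathematicalPhysics.QuantumLattice.pairField Literature.MathematicalPhysics.QuantumLattice.dWaveFormFactor L))).re / (β * (L : ℝ) ^ 2)) - μ * ((2 * ⌊(1 - δ) * (L : ℝ) ^ 2 / 2⌋₊) : ℝ) / (L : ℝ) ^ 2 ≤ Real.log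 4 / β + ε

/-- verbatim body of `Theses.ThermalWedge.TwSourcedCondensation` (rev 9). -/
def C' : Prop :=
  ∀ μ₁ μ₂ : ℝ, -4 < μ₁ → μ₁ ≤ μ₂ → μ₂ < 0 → ∃ U₀ a c C h₀ : ℝ, 0 < U₀ ∧ 0 < a ∧ 0 < c ∧ 0 < C ∧ 0 < h₀ ∧ ∀ U : ℝ, 0 < U → U ≤ U₀ → ∀ β : ℝ, 1 ≤ β → β ≤ Real.exp (a / U) → ∀ μ ∈ Set.Icc μ₁ μ₂, ∃ L₀ : ℕ, ∀ (L : ℕ) [NeZero L], L₀ ≤ L → ∀ h : ℝ, |h| ≤ h₀ → c * h ^ 2 * Real.log (1 / (|h| + 1 / β)) - C * h ^ 2 ≤ (Real.log (Matrix.partitionFn β (Literature.MathematicalPhysics.QuantumLattice.dWaveSourceTorus L U μ h)).re / (β * (L : ℝ) ^ 2)) - (Real.log (Matrix.partitionFn β (Literature.MathematicalPhysics.QuantumLattice.dWaveSourceTorus L U μ 0)).re / (β * (L : ℝ) ^ 2))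

/-- verbatim body of `Theses.ThermalWedge.TwSeededRung` (rev 9). -/
def Rung' : Prop :=
  ∀ δ ∈ Set.Icc (1/10 : ℝ) (2/5 : ℝ), ∃ U₀ K : ℝ, 0 < U₀ ∧ 0 < K ∧ K * U₀ ≤ 1 / 20 ∧ ∀ U ∈ Set.Ioc (0 : ℝ) U₀, (∀ g ∈ Set.Icc (K * U) (1 / 10), ∃ c : ℝ, 0 < c ∧ ∃ L₀ : ℕ, ∀ (L : ℕ) [NeZero L], L₀ ≤ L → Even L → ∀ (ψ : Literature.MathematicalPhysics.QuantumLattice.Fock (Literature.MathematicalPhysics.QuantumLattice.Orb (Literature.MathematicalPhysics.QuantumLattice.FermionTorus 2 L))), star ψ ⬝ᵥ ψ = 1 → Literature.MathematicalPhysics.QuantumLattice.IsGroundStateInSector (Literature.MathematicalPhysics.QuantumLattice.hubbardTorus 2 L 1 U - ((g / (L : ℝ) ^ 2 : ℝ) : ℂ) • ((Literature.MathematicalPhysics.QuantumLattice.pairField Literature.MathematicalPhysics.QuantumLattice.dWaveFormFactor L)ᴴ * Literature.MathematicalPhysics.QuantumLattice.pairField Literature.MathematicalPhysics.QuantumLattice.dWaveFormFactor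 L)) (2 * ⌊(1 - δ) * (L : ℝ) ^ 2 / 2⌋₊) 0 ψ → c * (L : ℝ) ^ 4 ≤ (Literature.MathematicalPhysics.QuantumLattice.expect ((Literature.MathematicalPhysics.QuantumLattice.pairField Literature.MathematicalPhysics.QuantumLattice.dWaveFormFactor L)ᴴ * Literature.MathematicalPhysics.QuantumLattice.pairField Literature.MathematicalPhysics.QuantumLattice.dWaveFormFactor L) ψ).re)

/-- verbatim shape of `Theses.ThermalWedge.TwThermalWindowRungGlue` (rev 9): `R → C → ⟨body of TwSeededRung⟩`. -/
def Glue' : Prop := R' → C' → Rung'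

/-! ## Idea 1 `engine-port` — first (and last) lemma: definitional application of the engine. -/

theorem glue_port : Glue' :=
  fun hE hC => twSeededRung_structural_thermalWindow hE hC

/-! ## Idea 2 `probe-schedule` — first lemma: from the two cruxes, a PROBE SCHEDULE with positive
margin (hypothesis `H` of the schedule-agnostic anchor theorem `twSeededRung_of_probe`), at
`(β, μ, s) = (e^{a/U}, μ_E, e^{-a/(4U)})`, `a = min aᵉ aᶜ`; then `twSeededRung_of_probe` closes. -/

theorem probe_schedule_of_cruxes (hE : R') (hC : C') :
    ∀ δ ∈ Set.Icc (1/10 : ℝ) (2/5 : ℝ), ∃ U₀ K : ℝ, 0 < U₀ ∧ 0 < K ∧ K * U₀ ≤ 1 / 20 ∧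
      ∀ U ∈ Set.Ioc (0 : ℝ) U₀, ∀ g ∈ Set.Icc (K * U) (1 / 10), ∃ m : ℝ, 0 < m ∧ ∃ L₀ : ℕ,
        ∀ (L : ℕ) [NeZero L], L₀ ≤ L → Even L → ∃ β μ s : ℝ, 0 < β ∧
          m ≤ (Real.log (partitionFn β (dWaveSourceTorus L U μ s)).re / (β * (L : ℝ) ^ 2) -
                Real.log (partitionFn β (dWaveSourceTorus L U μ 0)).re / (β * (L : ℝ) ^ 2)) -
              s ^ 2 / g -
              ((hubbardTorus 2 L 1 U - ((g / (L : ℝ) ^ 2 : ℝ) : ℂ) •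
                    ((pairField dWaveFormFactor L)ᴴ * pairField dWaveFormFactor L)).minEnergyOn
                  (szSector (Λ := FermionTorus 2 L) (2 * ⌊(1 - δ) * (L : ℝ) ^ 2 / 2⌋₊) 0) /
                    (L : ℝ) ^ 2 +
                Real.log (partitionFn β (hubbardTorusWith 2 L 1 U μ -
                  ((g / (L : ℝ) ^ 2 : ℝ) : ℂ) •
                    ((pairField dWaveFormFactor L)ᴴ * pairField dWaveFormFactor L))).re /
                      (β * (L : ℝ) ^ 2) -
                μ * ((2 * ⌊(1 - δ) * (L : ℝ) ^ 2 / 2⌋₊ : ℕ) : ℝ) / (L : ℝ) ^ 2) := by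
  sorry

/-- Idea 2, composition (kernel-checked modulo the first lemma): the glue from the probe schedule. -/
theorem glue_of_probe_schedule : Glue' :=
  fun hE hC => twSeededRung_of_probe (probe_schedule_of_cruxes hE hC)

end Summit.HubbardSuperconductivity.HubbardSuperconductivity.Cruxes.TwThermalWindowRungGlue.Sketch
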